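import Summits.KontsevichZagierPeriods.KontsevichZagierPeriods.Theorems.MultivaluedCoVEllipticAreaIdentityLattice
import Literature.NumberTheory.EllipticCurves.ComplexTorus
import HarnessLib

/-!
# `℘` maps the open quarter rectangle onto the open upper half-plane, via the addition law

Helper file for the support item `EllipticAreaIdentity` of route `MultivaluedCoV`
(`Summits/KontsevichZagierPeriods/KontsevichZagierPeriods/Theses/MultivaluedCoV.lean`).

Let `Λ` be a rectangular real lattice (Mathlib `PeriodPair` `L`, `L.IsReal`,
`(Ω₀ + iΩ₀')/2 ∉ Λ`) with real invariants `g₂, g₃`, `f(x) = 4x³ − g₂x − g₃`, roots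
`e₁ = ℘(Ω₀/2)` and `e₃ = ℘(iΩ₀'/2)`. Let `a : (e₁, ∞) → (0, Ω₀/2)` and `c : (−∞, e₃) → (0, Ω₀'/2)`
invert `℘` on the real and on the imaginary half-period segment (`℘(a s) = s`, `℘'(a s) = −√f(s)`;
`℘(i c t) = t`, `℘'(i c t) = −i√(−f(t))`; file `…Param`), and put `ζ(s,t) = a(s) − i c(t)`, a
bijection of `R = (e₁, ∞) × (−∞, e₃)` onto the open quarter rectangle `(0, Ω₀/2) × (−Ω₀'/2, 0)`.

* `weierstrassP_sub_I_mul_eq`: the addition theorem (`PeriodPair.weierstrassP_add_holds`,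
  Lawden (6.8.6)) gives the **algebraic** formula `℘(ζ(s,t)) = u + iv`,
  `u = −s − t + (f(s)+f(t))/(4(s−t)²)`, `v = √(−f(s)f(t))/(2(s−t)²) > 0` — the route's map
  `Φ` of crux `EllipticAreaCoV` (the group law of `y² = f(x)` through the uniformisation);
* `injOn_weierstrassP_zeta`: `(s,t) ↦ ℘(ζ(s,t))` is injective on `R`;
* `exists_weierstrassP_zeta_eq`: every `w` with `im w > 0` is `℘(ζ(s,t))` for some `(s,t) ∈ R`
  (`℘` takes every value, `PeriodPair.exists_weierstrassP_eq`; reduce the preimage into the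
  period rectangle, off the grid lines where `℘` is real, and use evenness and
  `℘(z̄) = conj ℘(z)` to place it in the fourth quarter rectangle).

Together: `℘` maps the open quarter rectangle bijectively onto the open upper half-plane
(Lawden, *Elliptic Functions and Applications*, §6.11, p. 170; Whittaker–Watson §20.32), in the
algebraic coordinates `(s, t)`.

## References
* D. F. Lawden, *Elliptic Functions and Applications*, Springer 1989, §6.8, §§6.11–6.12.
* E. T. Whittaker, G. N. Watson, *A Course of Modern Analysis*, §20.32.
* J. V. Armitage, W. F. Eberlein, *Elliptic Functions*, CUP 2006, §7.4.2.
-/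

noncomputable section

open scoped ComplexConjugate Topology PeriodPair
open Complex Set Filter

namespace Summit.KontsevichZagierPeriods.MultivaluedCoV.EllipticArea

variable {L : PeriodPair}

/-! ### The addition law as an algebraic map -/


/-- Pure algebra behind the addition formula: for reals `s ≠ t`, `P`, `Q`,
`((−P − iQ)/(s − t))²/4 − s − t = (−s − t + (P² − Q²)/(4(s−t)²)) + i · PQ/(2(s−t)²)`. -/
theorem addition_algebra {s t P Q : ℝ} (hst : s ≠ t) :
    ((-(P : ℂ) - I * Q) / ((s : ℂ) - t)) ^ 2 / 4 - s - t =
      ((-s - t + (P ^ 2 - Q ^ 2) / (4 * (s - t) ^ 2) : ℝ) : ℂ) +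
        ((P * Q / (2 * (s - t) ^ 2) : ℝ) : ℂ) * I := by
  have hd : ((s : ℂ) - t) ≠ 0 := by
    rw [sub_ne_zero]
    exact_mod_cast hst
  push_cast
  field_simp
  ring_nf
  rw [Complex.I_sq]
  ring

/-- **The addition law as an algebraic map.** For a lattice with real invariants, if
`℘(α) = s`, `℘'(α) = −√f(s)` and `℘(iγ) = t`, `℘'(iγ) = −i√(−f(t))` with `f(s) > 0 > f(t)`
(`f = 4x³ − g₂x − g₃`), then
`℘(α − iγ) = (−s − t + (f(s)+f(t))/(4(s−t)²)) + i · √(−f(s)f(t))/(2(s−t)²)`.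
(Addition theorem `PeriodPair.weierstrassP_add_holds`; Lawden (6.8.6).) -/
theorem weierstrassP_sub_I_mul_eq {α γ s t : ℝ}
    (hαΛ : (α : ℂ) ∉ L.lattice) (hγΛ : I * (γ : ℂ) ∉ L.lattice)
    (hα : ℘[L] α = s)
    (hα' : ℘'[L] α = -(Real.sqrt (4 * s ^ 3 - L.g₂.re * s - L.g₃.re) : ℝ))
    (hγ : ℘[L] (I * γ) = t)
    (hγ' : ℘'[L] (I * γ) = -I * (Real.sqrt (-(4 * t ^ 3 - L.g₂.re * t - L.g₃.re)) : ℝ))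
    (hfs : 0 < 4 * s ^ 3 - L.g₂.re * s - L.g₃.re) (hft : 4 * t ^ 3 - L.g₂.re * t - L.g₃.re < 0) :
    ℘[L] (α - I * γ) =
      ((-s - t + ((4 * s ^ 3 - L.g₂.re * s - L.g₃.re) + (4 * t ^ 3 - L.g₂.re * t - L.g₃.re)) /
          (4 * (s - t) ^ 2) : ℝ) : ℂ) +
        ((Real.sqrt (-((4 * s ^ 3 - L.g₂.re * s - L.g₃.re) *
            (4 * t ^ 3 - L.g₂.re * t - L.g₃.re))) / (2 * (s - t) ^ 2) : ℝ) : ℂ) * I := by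
  set fs := 4 * s ^ 3 - L.g₂.re * s - L.g₃.re with hfs_def
  set ft := 4 * t ^ 3 - L.g₂.re * t - L.g₃.re with hft_def
  set P := Real.sqrt fs with hP
  set Q := Real.sqrt (-ft) with hQ
  have hst : s ≠ t := by
    rintro rfl
    exact absurd hfs (not_lt.mpr hft.le)
  have hP2 : P ^ 2 = fs := Real.sq_sqrt hfs.le
  have hQ2 : Q ^ 2 = -ft := Real.sq_sqrt (by linarith)
  have hPQ : Real.sqrt (-(fs * ft)) = P * Q := by
    rw [hP, hQ, ← Real.sqrt_mul hfs.le]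
    ring_nf
  -- the point `-iγ`
  have hγΛ' : -(I * (γ : ℂ)) ∉ L.lattice := fun h' => hγΛ (by simpa using neg_mem h')
  have hγn : ℘[L] (-(I * γ)) = t := by rw [L.weierstrassP_neg, hγ]
  have hγn' : ℘'[L] (-(I * γ)) = I * Q := by
    rw [L.derivWeierstrassP_neg, hγ']
    ring
  have hne : ℘[L] α ≠ ℘[L] (-(I * γ)) := by
    rw [hα, hγn]
    exact_mod_cast hst
  have hadd := L.weierstrassP_add_holds α (-(I * γ)) hαΛ hγΛ' hne
  rw [show (α : ℂ) - I * γ = α + -(I * γ) by ring, hadd, hα, hγn, hα', hγn', hPQ,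
    show fs + ft = P ^ 2 - Q ^ 2 by rw [hP2, hQ2]; ring]
  have := addition_algebra (P := P) (Q := Q) hst
  rw [← this]

/-- The imaginary part of the addition-law map is positive: `√(−f(s)f(t))/(2(s−t)²) > 0` for
`f(s) > 0 > f(t)`. -/
theorem addition_im_pos {A B s t : ℝ} (hfs : 0 < 4 * s ^ 3 - A * s - B)
    (hft : 4 * t ^ 3 - A * t - B < 0) :
    0 < Real.sqrt (-((4 * s ^ 3 - A * s - B) * (4 * t ^ 3 - A * t - B))) / (2 * (s - t) ^ 2) := by
  have hst : s - t ≠ 0 := by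
    intro h0
    have : s = t := by linarith
    subst this
    exact absurd hfs (not_lt.mpr hft.le)
  have h1 : 0 < -((4 * s ^ 3 - A * s - B) * (4 * t ^ 3 - A * t - B)) := by nlinarith
  have h2 : 0 < (s - t) ^ 2 := by positivity
  exact div_pos (Real.sqrt_pos.mpr h1) (by linarith)


/-! ### The map `(s, t) ↦ ℘(a(s) − i c(t))` on `R = (e₁, ∞) × (−∞, e₃)` -/

section Zeta

variable (h : L.IsReal)
  (hrect : ((L.minRealPeriod : ℂ) + I * (L.mulLeft I I_ne_zero).minRealPeriod) / 2 ∉ L.lattice)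
  {e₁ e₃ : ℝ} (he₁ : e₁ = L.weierstrassPRe (L.minRealPeriod / 2))
  (he₃ : e₃ = -(L.mulLeft I I_ne_zero).weierstrassPRe ((L.mulLeft I I_ne_zero).minRealPeriod / 2))
  {a c : ℝ → ℝ}
  (ha : ∀ x, e₁ < x → a x ∈ Ioo 0 (L.minRealPeriod / 2) ∧ ℘[L] (a x) = x ∧
    ℘'[L] (a x) = -(Real.sqrt (4 * x ^ 3 - L.g₂.re * x - L.g₃.re) : ℝ))
  (ha2 : ∀ t ∈ Ioo 0 (L.minRealPeriod / 2), a ((℘[L] t).re) = t)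
  (hc : ∀ t, t < e₃ → c t ∈ Ioo 0 ((L.mulLeft I I_ne_zero).minRealPeriod / 2) ∧
    ℘[L] (I * c t) = t ∧
    ℘'[L] (I * c t) = -I * (Real.sqrt (-(4 * t ^ 3 - L.g₂.re * t - L.g₃.re)) : ℝ))
  (hc2 : ∀ u ∈ Ioo 0 ((L.mulLeft I I_ne_zero).minRealPeriod / 2), c ((℘[L] (I * u)).re) = u)

include h he₁ he₃ ha hc

omit he₁ he₃ hc in
/-- `a s ∉ Λ` for `s > e₁` (it lies in `(0, Ω₀/2)`). -/
theorem ofReal_a_notMem {s : ℝ} (hs : e₁ < s) : ((a s : ℝ) : ℂ) ∉ L.lattice :=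
  h.ofReal_notMem_lattice (ha s hs).1.1 (by linarith [(ha s hs).1.2, h.minRealPeriod_pos])

omit he₁ he₃ ha in
/-- `i c t ∉ Λ` for `t < e₃` (it lies on `i(0, Ω₀'/2)`). -/
theorem I_mul_c_notMem {t : ℝ} (ht : t < e₃) : I * ((c t : ℝ) : ℂ) ∉ L.lattice := by
  intro hmem
  have h' := h.mulLeft_I
  have h1 : I * (I * ((c t : ℝ) : ℂ)) ∈ (L.mulLeft I I_ne_zero).lattice :=
    PeriodPair.mul_mem_mulLeft_lattice.mpr hmem
  rw [← mul_assoc, Complex.I_mul_I, neg_one_mul] at h1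
  have h2 : ((c t : ℝ) : ℂ) ∈ (L.mulLeft I I_ne_zero).lattice := by simpa using neg_mem h1
  exact h'.ofReal_notMem_lattice (hc t ht).1.1
    (by linarith [(hc t ht).1.2, h'.minRealPeriod_pos]) h2

/-- **The addition-law formula on `R`**: for `s > e₁`, `t < e₃`,
`℘(a s − i c t) = (−s − t + (f s + f t)/(4(s−t)²)) + i √(−f(s)f(t))/(2(s−t)²)`. -/
theorem weierstrassP_zeta_eq {s t : ℝ} (hs : e₁ < s) (ht : t < e₃) :
    ℘[L] ((a s : ℂ) - I * c t) =
      ((-s - t + ((4 * s ^ 3 - L.g₂.re * s - L.g₃.re) + (4 * t ^ 3 - L.g₂.re * t - L.g₃.re)) /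
          (4 * (s - t) ^ 2) : ℝ) : ℂ) +
        ((Real.sqrt (-((4 * s ^ 3 - L.g₂.re * s - L.g₃.re) *
            (4 * t ^ 3 - L.g₂.re * t - L.g₃.re))) / (2 * (s - t) ^ 2) : ℝ) : ℂ) * I :=
  weierstrassP_sub_I_mul_eq (ofReal_a_notMem h ha hs) (I_mul_c_notMem h hc ht)
    (ha s hs).2.1 (ha s hs).2.2 (hc t ht).2.1 (hc t ht).2.2
    (h.cubic_pos_of_lt (by rw [← he₁]; exact hs)) (h.cubic_neg_of_lt (by rw [← he₃]; exact ht))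

/-- The values `℘(a s − i c t)`, `(s,t) ∈ R`, lie in the open upper half-plane. -/
theorem weierstrassP_zeta_im_pos {s t : ℝ} (hs : e₁ < s) (ht : t < e₃) :
    0 < (℘[L] ((a s : ℂ) - I * c t)).im := by
  rw [weierstrassP_zeta_eq h he₁ he₃ ha hc hs ht]
  simp only [add_im, ofReal_im, mul_im, ofReal_re, I_im, mul_one, I_re, mul_zero, add_zero,
    zero_add]
  exact addition_im_pos (h.cubic_pos_of_lt (by rw [← he₁]; exact hs))
    (h.cubic_neg_of_lt (by rw [← he₃]; exact ht))

omit h he₁ he₃ in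
/-- `a s − i c t` lies in the open quarter rectangle `(0, Ω₀/2) × (−Ω₀'/2, 0)`. -/
theorem zeta_mem_quarter {s t : ℝ} (hs : e₁ < s) (ht : t < e₃) :
    0 < ((a s : ℂ) - I * c t).re ∧ ((a s : ℂ) - I * c t).re < L.minRealPeriod / 2 ∧
      -((L.mulLeft I I_ne_zero).minRealPeriod / 2) < ((a s : ℂ) - I * c t).im ∧
      ((a s : ℂ) - I * c t).im < 0 := by
  have h1 := (ha s hs).1
  have h2 := (hc t ht).1
  simp only [sub_re, ofReal_re, mul_re, I_re, zero_mul, I_im, ofReal_im, mul_zero, sub_zero,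
    one_mul, sub_im, mul_im, zero_sub, zero_add]
  exact ⟨h1.1, h1.2, by linarith [h2.2], by linarith [h2.1]⟩

omit he₁ he₃ in
include hrect in
/-- **Injectivity**: `(s,t) ↦ ℘(a s − i c t)` is injective on `R = (e₁, ∞) × (−∞, e₃)`
(`℘` is injective on the quarter rectangle, and `℘(a s) = s`, `℘(i c t) = t` recover `s, t`). -/
theorem injOn_weierstrassP_zeta :
    InjOn (fun z : Fin 2 → ℝ => ℘[L] ((a (z 0) : ℂ) - I * c (z 1)))
      {z : Fin 2 → ℝ | e₁ < z 0 ∧ z 1 < e₃} := by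
  intro z hz z' hz' heq
  have hq := zeta_mem_quarter ha hc hz.1 hz.2
  have hq' := zeta_mem_quarter ha hc hz'.1 hz'.2
  have hζ := injOn_weierstrassP_quarter h hrect hq hq' heq
  have hre := congrArg Complex.re hζ
  have him := congrArg Complex.im hζ
  simp only [sub_re, ofReal_re, mul_re, I_re, zero_mul, I_im, ofReal_im, mul_zero, sub_zero,
    one_mul, sub_im, mul_im, zero_sub, zero_add, neg_inj] at hre him
  have h0 : z 0 = z' 0 := by
    have e1 := (ha (z 0) hz.1).2.1
    have e2 := (ha (z' 0) hz'.1).2.1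
    rw [hre] at e1
    exact_mod_cast e1.symm.trans e2
  have h1 : z 1 = z' 1 := by
    have e1 := (hc (z 1) hz.2).2.1
    have e2 := (hc (z' 1) hz'.2).2.1
    rw [him] at e1
    exact_mod_cast e1.symm.trans e2
  ext i
  fin_cases i
  · exact h0
  · exact h1

omit ha hc in
include ha2 hc2 in
/-- A point `z` of the open quarter rectangle `(0, Ω₀/2) × (−Ω₀'/2, 0)` is `a s − i c t` with
`(s,t) ∈ R`: `s = ℘(re z)`, `t = ℘(i · (−im z))`. -/
theorem exists_zeta_eq {z : ℂ} (h0 : 0 < z.re) (h1 : z.re < L.minRealPeriod / 2)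
    (h2 : -((L.mulLeft I I_ne_zero).minRealPeriod / 2) < z.im) (h3 : z.im < 0) :
    ∃ s t : ℝ, e₁ < s ∧ t < e₃ ∧ ((a s : ℂ) - I * c t) = z := by
  set L' := L.mulLeft I I_ne_zero with hL'
  have h' : L'.IsReal := h.mulLeft_I
  have hΩ := h.minRealPeriod_pos
  have hΩ' := h'.minRealPeriod_pos
  refine ⟨(℘[L] (z.re : ℂ)).re, (℘[L] (I * ((-z.im : ℝ) : ℂ))).re, ?_, ?_, ?_⟩
  · rw [he₁]
    have := h.strictAntiOn_weierstrassPRe ⟨h0, h1.le⟩ ⟨by linarith, le_rfl⟩ h1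
    exact this
  · rw [he₃, PeriodPair.weierstrassP_I_mul, ← hL', Complex.neg_re, neg_lt_neg_iff]
    have := h'.strictAntiOn_weierstrassPRe ⟨by linarith, by linarith⟩ ⟨by linarith, le_rfl⟩
      (by linarith : -z.im < L'.minRealPeriod / 2)
    exact this
  · rw [ha2 z.re ⟨h0, h1⟩, hc2 (-z.im) ⟨by linarith, by linarith⟩]
    apply Complex.ext
    · simp
    · simp

include hrect ha2 hc2 in
/-- **Surjectivity onto the upper half-plane**: every `w` with `im w > 0` is `℘(a s − i c t)` for
some `s > e₁`, `t < e₃` (Lawden §6.11: `℘` maps the quarter rectangle onto a half-plane). -/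
theorem exists_weierstrassP_zeta_eq {w : ℂ} (hw : 0 < w.im) :
    ∃ z : Fin 2 → ℝ, z ∈ {z : Fin 2 → ℝ | e₁ < z 0 ∧ z 1 < e₃} ∧
      ℘[L] ((a (z 0) : ℂ) - I * c (z 1)) = w := by
  have hΩ := h.minRealPeriod_pos
  have hΩ' := h.mulLeft_I.minRealPeriod_pos
  -- a preimage, reduced into the period rectangle
  obtain ⟨z₀, -, hz₀⟩ := L.exists_weierstrassP_eq w
  obtain ⟨z₁, hsub, hre, him⟩ := exists_sub_mem_lattice_abs_le h hrect z₀
  have hPz₁ : ℘[L] z₁ = w := by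
    have := L.weierstrassP_add_coe z₀ ⟨_, hsub⟩
    rw [show z₀ + (z₁ - z₀) = z₁ by ring] at this
    rw [this, hz₀]
  have him_ne : (℘[L] z₁).im ≠ 0 := by rw [hPz₁]; exact hw.ne'
  obtain ⟨hre0, hre1⟩ := abs_re_pos_lt_of_im_ne_zero h him_ne hre
  obtain ⟨him0, him1⟩ := abs_im_pos_lt_of_im_ne_zero h him_ne him
  -- points of an open quarter rectangle with `re > 0`
  have key : ∀ z : ℂ, ℘[L] z = w → 0 < z.re → z.re < L.minRealPeriod / 2 → 0 < |z.im| →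
      |z.im| < (L.mulLeft I I_ne_zero).minRealPeriod / 2 →
      ∃ zz : Fin 2 → ℝ, zz ∈ {z : Fin 2 → ℝ | e₁ < z 0 ∧ z 1 < e₃} ∧
        ℘[L] ((a (zz 0) : ℂ) - I * c (zz 1)) = w := by
    intro z hz h0 h1 h2 h3
    rcases lt_or_gt_of_ne (abs_pos.mp h2) with hneg | hpos
    · -- fourth quadrant: `z = a s - i c t`
      rw [abs_of_neg hneg] at h3
      obtain ⟨s, t, hs, ht, hζ⟩ := exists_zeta_eq h he₁ he₃ ha2 hc2 h0 h1 (by linarith) hneg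
      exact ⟨![s, t], ⟨hs, ht⟩, by simp [hζ, hz]⟩
    · -- first quadrant: `conj z = a s - i c t` would give `im ℘ > 0` at `conj w`
      exfalso
      rw [abs_of_pos hpos] at h3
      obtain ⟨s, t, hs, ht, hζ⟩ := exists_zeta_eq h he₁ he₃ ha2 hc2 (z := conj z)
        (by simpa using h0) (by simpa using h1) (by simp; linarith) (by simpa using hpos)
      have h4 := weierstrassP_zeta_im_pos h he₁ he₃ ha hc hs ht
      rw [hζ, h.weierstrassP_conj, hz, Complex.conj_im] at h4
      linarith
  rcases lt_or_gt_of_ne (abs_pos.mp hre0) with hneg | hpos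
  · -- `re z₁ < 0`: use `-z₁`
    refine key (-z₁) (by rw [L.weierstrassP_neg, hPz₁]) (by simp; linarith) ?_ ?_ ?_
    · rw [abs_of_neg hneg] at hre1; simp; linarith
    · simpa using him0
    · simpa using him1
  · rw [abs_of_pos hpos] at hre1
    exact key z₁ hPz₁ hpos hre1 him0 him1

end Zeta

end Summit.KontsevichZagierPeriods.MultivaluedCoV.EllipticArea

end
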